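import Summits.NavierStokesRegularity.FunctionalMining.TopEigHeatCoercive
import Literature.Analysis.Matrix.KyFanMaximumPrinciple
import HarnessLib

/-!
# FunctionalMining — the `v ↦ −v` symmetry of Lemma L-λ (dict seat, staged)

HONEST FRAMING. Search for candidate a priori estimates; no regularity claim. Nothing about
Navier–Stokes is proved or asserted here. This file proves the elementary STATIC symmetry left open in
`TopEigHeatCoercive.lean` (its docstring: "the `−λ₃` core of `v` is the `λ₁` core of `−v` … the two
families are equivalent by `v ↦ −v`, not proved here"):

* `torusStrainMatrix_neg`: `S_{−v} = −S_v`; `torusStrainEig_neg`: the sorted strain eigenvalues of `−v`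
  are `λ_j(−v) = −λ_{rev j}(v)` (Horn–Johnson Obs. 4.2.5 via the tree's
  `Literature.Analysis.Matrix.KyFan.eigenvalues₀_neg`); hence `torusStrainTopEig_neg`
  (`λ₁(−v) = −λ₃(v)`), `torusStrainBotEig_neg`, and the moment identities
  `torusTopEigMoment q (−v) = torusNegBotEigMoment q v`, `torusNegBotEigMoment q (−v) = torusTopEigMoment q v`;
* `Torus.laplacian`, `Torus.divergence`, zero mean and smoothness commute with negation, so
  `heatDissipation Φ (−v) = heatDissipation (Φ ∘ Neg) v` and `HeatCoercive (Φ ∘ Neg) c ↔ HeatCoercive Φ c`;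
* **`negBotEigHeatCoercive_iff : NegBotEigHeatCoercive q c ↔ TopEigHeatCoercive q c`** and
  **`negBotEigHeatCoercivePos_iff : NegBotEigHeatCoercivePos q ↔ TopEigHeatCoercivePos q`** — the two
  halves of the A12 open cell (K0 rows `ES.lam1.q | T_LD | G1` and `ES.neglam3.q | T_LD | G1`, `q = 2, 3, 4`,
  conditional on Lemma L-λ) are ONE open question, at every rate `c` and every exponent `q`.

What this does NOT say: the six `T_LD` ROWS themselves (`TopEigMomentSaturatingLaw` /
`NegBotEigMomentSaturatingLaw`) are NOT identified — `v ↦ −v` is a symmetry of the heat flow, not of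
Navier–Stokes, so only the static coercivity lemma is symmetric (as SIEVELD §3.4b states). No verdict
changes: A12 stays 18 HOLDS ∃κ / 6 conditional / 24 FALSE ∀κ; the conditional six now visibly hang on a
single `Prop`, `TopEigHeatCoercivePos q`.

[ours: `pub-nsfunc` dict seat g18, 2026-08-21; bookkeeping over the tree's `StrainEigen`,
`TopEigHeatCoercive` (p236628) and `Literature.Analysis.Matrix.KyFanMaximumPrinciple`
(`eigenvalues₀_neg`, [cite: HornJohnson2013, Obs. 4.2.5]). No literature claim is made.]
-/

noncomputable section

namespace Summit.NavierStokesRegularity.FunctionalMining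

open MeasureTheory Set Literature.Analysis.FunctionSpaces Literature.Analysis.FluidPDE

variable {d : Type*} [Fintype d] [DecidableEq d]

/-! ### Negation and the torus calculus (no differentiability needed except where stated) -/

section TorusNeg

variable {F : Type*} [NormedAddCommGroup F] [NormedSpace ℝ F]

omit [Fintype d] in
/-- `∂ᵢ(−f) = −∂ᵢ f` pointwise (junk-value compatible: `deriv (−g) = −deriv g` unconditionally).
[folklore] -/
theorem torus_partialDeriv_neg (i : d) (f : UnitAddTorus d → F) (x : UnitAddTorus d) :
    Torus.partialDeriv i (-f) x = -Torus.partialDeriv i f x := by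
  simp only [Torus.partialDeriv, Torus.lineDeriv, Pi.neg_apply]
  exact deriv.fun_neg

omit [Fintype d] [DecidableEq d] in
/-- `Δ(−f) = −Δf` pointwise on the torus (Mathlib's `InnerProductSpace.laplacian_neg`, unconditional).
[folklore] -/
theorem torus_laplacian_neg [Fintype d] (f : UnitAddTorus d → F) (x : UnitAddTorus d) :
    Torus.laplacian (-f) x = -Torus.laplacian f x := by
  rw [Torus.laplacian, Torus.laplacian,
    show Torus.liftAt (-f) x = -Torus.liftAt f x from rfl, InnerProductSpace.laplacian_neg,
    Pi.neg_apply]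

omit [Fintype d] [DecidableEq d] in
/-- `Δ(−f) = −Δf` as functions. [folklore] -/
theorem torus_laplacian_neg' [Fintype d] (f : UnitAddTorus d → F) :
    Torus.laplacian (-f) = -Torus.laplacian f :=
  funext fun x => by rw [torus_laplacian_neg, Pi.neg_apply]

omit [Fintype d] [DecidableEq d] in
/-- `−f` has zero mean iff `f` has. [folklore] -/
theorem torus_hasZeroMean_neg_iff [Fintype d] (f : UnitAddTorus d → F) :
    Torus.HasZeroMean (-f) ↔ Torus.HasZeroMean f := by
  simp only [Torus.HasZeroMean, Pi.neg_apply, integral_neg, neg_eq_zero]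

end TorusNeg

/-- `div(−u) = −div u` pointwise. [folklore] -/
theorem torus_divergence_neg (u : UnitAddTorus d → EuclideanSpace ℝ d) (x : UnitAddTorus d) :
    Torus.divergence (-u) x = -Torus.divergence u x := by
  simp only [Torus.divergence, ← Finset.sum_neg_distrib]
  refine Finset.sum_congr rfl fun i _ => ?_
  have h : (fun y => (-u) y i) = -fun y => u y i := by
    funext y; simp
  rw [h, torus_partialDeriv_neg]

/-- `−u` is divergence free iff `u` is. [folklore] -/
theorem torus_isDivFree_neg_iff (u : UnitAddTorus d → EuclideanSpace ℝ d) :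
    Torus.IsDivFree (-u) ↔ Torus.IsDivFree u := by
  simp only [Torus.IsDivFree, torus_divergence_neg, neg_eq_zero]

/-! ### The strain of `−v` and its sorted eigenvalues -/

/-- `S_{−v}(x) = −S_v(x)`. [folklore] -/
theorem torusStrainMatrix_neg (v : UnitAddTorus d → EuclideanSpace ℝ d) (x : UnitAddTorus d) :
    torusStrainMatrix (-v) x = -torusStrainMatrix v x := by
  ext i j
  simp only [torusStrainMatrix, Matrix.of_apply, Matrix.neg_apply, torus_partialDeriv_neg,
    PiLp.neg_apply]
  ring

omit [Fintype d] [DecidableEq d] in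
/-- Transport of Mathlib's sorted eigenvalues along an equality of matrices (the `IsHermitian` proof is
a `Prop`, so only the matrix matters). [folklore, bookkeeping] -/
theorem eigenvalues₀_congr_of_eq [Fintype d] [DecidableEq d] {A B : Matrix d d ℝ}
    (hA : A.IsHermitian) (hB : B.IsHermitian) (h : A = B) : hA.eigenvalues₀ = hB.eigenvalues₀ := by
  subst h; rfl

/-- **The sorted strain eigenvalues of `−v`: `λ_j(−v)(x) = −λ_{rev j}(v)(x)`** (decreasing order;
`rev j = n − 1 − j`; at `card d = 3`: `λ₁(−v) = −λ₃(v)`, `λ₂(−v) = −λ₂(v)`, `λ₃(−v) = −λ₁(v)`).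
Horn–Johnson Obs. 4.2.5 through the tree's `KyFan.eigenvalues₀_neg`. [folklore] -/
theorem torusStrainEig_neg (v : UnitAddTorus d → EuclideanSpace ℝ d) (x : UnitAddTorus d)
    (j : Fin (Fintype.card d)) :
    torusStrainEig (-v) x j = -torusStrainEig v x (Fin.rev j) := by
  have hneg : (-torusStrainMatrix v x).IsHermitian := (torusStrainMatrix_isHermitian v x).neg
  unfold torusStrainEig
  rw [eigenvalues₀_congr_of_eq (torusStrainMatrix_isHermitian (-v) x) hneg (torusStrainMatrix_neg v x)]
  exact Literature.Analysis.Matrix.KyFan.eigenvalues₀_neg (torusStrainMatrix_isHermitian v x) hneg j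

omit [Fintype d] [DecidableEq d] in
/-- `⨆ᵢ (−fᵢ) = −⨅ᵢ fᵢ` for a real family (Mathlib's `Real.sSup_neg`, valid with the junk conventions:
no finiteness or boundedness needed). [folklore, bookkeeping] -/
theorem real_iSup_neg_eq {ι : Type*} (f : ι → ℝ) : (⨆ i, -f i) = -⨅ i, f i := by
  rw [iSup, iInf, ← Real.sSup_neg]
  congr 1
  ext y
  simp only [Set.mem_range, Set.mem_neg]
  constructor
  · rintro ⟨i, rfl⟩; exact ⟨i, by rw [neg_neg]⟩
  · rintro ⟨i, hi⟩; exact ⟨i, by rw [hi, neg_neg]⟩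

/-- **`λ₁(−v) = −λ₃(v)` pointwise** (top eigenvalue of `−S` = minus the bottom eigenvalue of `S`;
binder-free in `d`, junk-compatible). [folklore] -/
theorem torusStrainTopEig_neg (v : UnitAddTorus d → EuclideanSpace ℝ d) (x : UnitAddTorus d) :
    torusStrainTopEig (-v) x = -torusStrainBotEig v x := by
  unfold torusStrainTopEig torusStrainBotEig
  simp_rw [torusStrainEig_neg]
  rw [Fin.rev_surjective.iSup_comp (fun j => -torusStrainEig v x j)]
  exact real_iSup_neg_eq _

/-- **`λ₃(−v) = −λ₁(v)` pointwise.** [folklore] -/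
theorem torusStrainBotEig_neg (v : UnitAddTorus d → EuclideanSpace ℝ d) (x : UnitAddTorus d) :
    torusStrainBotEig (-v) x = -torusStrainTopEig v x := by
  have h := torusStrainTopEig_neg (-v) x
  rw [neg_neg] at h
  linarith

/-- **`∫(λ₁⁺)^q` of `−v` is `∫((−λ₃)⁺)^q` of `v`**: K0 core `ES.lam1.q` at `−v` = core `ES.neglam3.q` at `v`.
[ours, bookkeeping] -/
theorem torusTopEigMoment_neg (q : ℝ) (v : UnitAddTorus d → EuclideanSpace ℝ d) :
    torusTopEigMoment q (-v) = torusNegBotEigMoment q v := by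
  simp only [torusTopEigMoment, torusNegBotEigMoment, torusStrainTopEig_neg]

/-- `∫((−λ₃)⁺)^q` of `−v` is `∫(λ₁⁺)^q` of `v`. [ours, bookkeeping] -/
theorem torusNegBotEigMoment_neg (q : ℝ) (v : UnitAddTorus d → EuclideanSpace ℝ d) :
    torusNegBotEigMoment q (-v) = torusTopEigMoment q v := by
  simp only [torusTopEigMoment, torusNegBotEigMoment, torusStrainBotEig_neg, neg_neg]

/-- The two eigenvalue moments as functionals: `ES.neglam3.q = ES.lam1.q ∘ Neg`. [ours, bookkeeping] -/
theorem torusNegBotEigMoment_eq_comp_neg (q : ℝ) :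
    torusNegBotEigMoment (d := d) q = fun w => torusTopEigMoment q (-w) :=
  funext fun w => (torusTopEigMoment_neg q w).symm

/-! ### Heat dissipation and heat coercivity under `v ↦ −v` -/

omit [DecidableEq d] in
/-- `heatDissipation Φ (−v) = heatDissipation (Φ ∘ Neg) v`: the backward quotients of `Φ` along the line
`−v + tΔ(−v) = −(v + tΔv)` are those of `Φ ∘ Neg` along `v + tΔv`. [ours, bookkeeping] -/
theorem heatDissipation_neg (Φ : (UnitAddTorus d → EuclideanSpace ℝ d) → ℝ)
    (v : UnitAddTorus d → EuclideanSpace ℝ d) :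
    heatDissipation Φ (-v) = heatDissipation (fun w => Φ (-w)) v := by
  unfold heatDissipation
  congr 1
  funext t
  rw [torus_laplacian_neg', smul_neg, ← neg_add]

/-- **Heat coercivity is invariant under `Φ ↦ Φ ∘ Neg`** (smoothness, `div = 0` and zero mean are
preserved by `v ↦ −v`, and `heatDissipation_neg`). [ours, bookkeeping] -/
theorem heatCoercive_comp_neg_iff (Φ : (UnitAddTorus d → EuclideanSpace ℝ d) → ℝ) (c : ℝ) :
    HeatCoercive (fun w => Φ (-w)) c ↔ HeatCoercive Φ c := by
  constructor
  · intro h hd v hv hdiv hmean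
    have h' := h hd (-v) hv.neg ((torus_isDivFree_neg_iff v).2 hdiv)
      ((torus_hasZeroMean_neg_iff v).2 hmean)
    rw [← heatDissipation_neg Φ (-v), neg_neg] at h'
    simpa only [neg_neg] using h'
  · intro h hd v hv hdiv hmean
    have h' := h hd (-v) hv.neg ((torus_isDivFree_neg_iff v).2 hdiv)
      ((torus_hasZeroMean_neg_iff v).2 hmean)
    rw [heatDissipation_neg Φ v] at h'
    exact h'

/-- **The `−λ₃` row at rate `c` IS the `λ₁` row at rate `c`:
`NegBotEigHeatCoercive q c ↔ TopEigHeatCoercive q c`** (every real `q`, every real `c`). [ours, bookkeeping] -/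
theorem negBotEigHeatCoercive_iff (q c : ℝ) :
    NegBotEigHeatCoercive (d := d) q c ↔ TopEigHeatCoercive (d := d) q c := by
  unfold NegBotEigHeatCoercive TopEigHeatCoercive
  rw [torusNegBotEigMoment_eq_comp_neg]
  exact heatCoercive_comp_neg_iff _ _

/-- **Lemma L-λ(q) for the `−λ₃` core IS Lemma L-λ(q) for the `λ₁` core:
`NegBotEigHeatCoercivePos q ↔ TopEigHeatCoercivePos q`.** The six conditional `T_LD` rows of A12 hang on
ONE `Prop` per exponent, `TopEigHeatCoercivePos q`. [ours, bookkeeping] -/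
theorem negBotEigHeatCoercivePos_iff (q : ℝ) :
    NegBotEigHeatCoercivePos (d := d) q ↔ TopEigHeatCoercivePos (d := d) q := by
  unfold NegBotEigHeatCoercivePos TopEigHeatCoercivePos
  simp only [negBotEigHeatCoercive_iff]

/-- Bookkeeping corollary: the `−λ₃` conditional verdict needs only the `λ₁` lemma — Theorem G (ii) for the
`−λ₃` core (named implication `NegBotEigTLDOfCoercive q`, paper) and `TopEigHeatCoercivePos q` give the row
`ES.neglam3.q | T_LD` for all large `κ`. [ours, bookkeeping] -/
theorem negBotEigMomentSaturatingLaw_of_topEigCoercive {q : ℝ} (hG : NegBotEigTLDOfCoercive (d := d) q)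
    (hL : TopEigHeatCoercivePos (d := d) q) :
    ∃ κ₀ : ℝ, ∀ κ, κ₀ ≤ κ → NegBotEigMomentSaturatingLaw (d := d) q κ := by
  obtain ⟨κ₀, hκ₀⟩ := hG ((negBotEigHeatCoercivePos_iff q).2 hL)
  exact ⟨κ₀, fun κ hκ => hκ₀.mono_kappa hκ⟩

end Summit.NavierStokesRegularity.FunctionalMining

end
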